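import Literature.MathematicalPhysics.QuantumFieldTheory.Balaban1983to89.B15HDecayLeaves
import Literature.MathematicalPhysics.QuantumFieldTheory.Balaban1983to89.B15GammaSmallness

/-!
# `Balaban1983to89.B15Ineq142Proof` — [Balaban1989LargeFieldI] (1.42) p. 185: *"The function ℍ_{j+1,□′} is bounded on
# □′^{∼2} by B₃exp(−δLM₂R_{j+1})22d²ε_{j+1}, hence |V^{(j)}_{□′}(b) − V^{(j)}_Z(b)| = |exp iℍ^{(j)}_{□′}(b) − 1| <
# O(1)B₃exp(−δLM₂R_{j+1})22d²(1 + β₀)(A₀/A₁)δ_j ≦ ½δ_j"* — the MIDDLE member DERIVED from [15] (190) and the whole typed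
# leaf `Ineq142` END-TO-END (last member from the γ-clause), plus the clause `δ′_j < ¾δ_j` of (1.43)

statement-level skeleton of published theorems with citation tags; proofs where landed; nothing here is a claim about
the Yang–Mills mass gap.

CITATION HEADER (lean-in-tree rule 2026-08-18).  T. Bałaban, *Large field renormalization. I. The basic step of the 𝐑
operation*, Commun. Math. Phys. **122**, 175–202 (1989), doi:10.1007/BF01257412, bib `Balaban1989LargeFieldI` (cell
paper B15; PDF held `paper:balaban1989-cmp122-large-field-i`, journal page = PDF page + 174; p. 185 = PDF 11, OCR page
`p0011.txt` and the x2 render `…-p011-x2.png`).  "[15]" = [Balaban1985Variational] (190) p. 308 (tree: `B11SectG.Ineq190`);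
"[3]" = [Balaban1984PropagatorsII] (2.61) p. 234 (`B11SectG.RowSum`); "[III]" = [Balaban1988Convergent] (2.4)–(2.5)
p. 255 (`Setup.epsK`, `B14.IsRj`).  WHAT IS REPRODUCED: SKELETON rows `B15.Eq1.42` (middle and last member), `B15.Eq1.43`
(the clause `δ′_j < ¾δ_j` behind *"< 2δ_j"*), unit `lit-balaban-r12` gen 8 (reader/typer and fold owner of block B15),
HOME `run/shared/lean/pub/lit-balaban/` (`lit-balaban-r12/ROWS-B15.md`).  Used BY NAME, nothing restated: r12's
`B15HDecayLeaves.loc_le_of_meanValue` (one localised piece through (190)), `B15GammaSmallness.ineq142_second_of_gamma`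
(the last member from the explicit γ-clause), `B15GammaSmallness.logPow_ratio_le`, the typed leaf
`B15.PrelimIntegrations.Ineq142`, `Setup.epsK` / `B15.Ineq194Flow.deltaPrimeK` (`δ_j = g_jA₁p₀(g_j)`, `δ′_j = g_jA₁p₁(g_j)`).

THE PRINTED TEXT (p. 185, verbatim).  *"The configuration V^{(j)}_{□′} is equal to M^j(U_{j+1,□′}). For U_{j+1,□′} we
have the representation (1.30), with j, n, □, and ξ replaced by j + 1, n + 1, □′, and L⁻¹ξ. This representation implies
V^{(j)}_{□′} = (M^j(exp iL⁻¹ξℍ_{j+1,□′})M^j(U_k^{(n+1)}))^{…} = exp iℍ^{(j)}_{□′}V_Z^{(j)}, (1.40) where exp iℍ^{(j)}_{□′}(b) = …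
(1.41) For the configuration (1.41) we have again the bound (1.37), with ℍ replaced by ℍ_{j+1,□′} on the right-hand side,
and without the factor L. The function ℍ_{j+1,□′} is bounded on □′^{∼2} by B₃exp(−δLM₂R_{j+1})22d²ε_{j+1}, hence
|V^{(j)}_{□′}(b) − V^{(j)}_Z(b)| = |exp iℍ^{(j)}_{□′}(b) − 1| < O(1)B₃exp(−δLM₂R_{j+1})22d²(1 + β₀)(A₀/A₁)δ_j ≦ ½δ_j (1.42) on
□′^{∼2}."*; p. 185 (1.43): *"|V_j(b)(V^{(j)}_{□′}(b))⁻¹ − 1| ≦ … < 2δ′_j + ½δ_j < 2δ_j"*; p. 183 l. 1: *"δ′_j = g_jA₁p₁(g_j), p₁(g_j) =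
(log g_j⁻²)^{p₁}, and p₁ < p₀"*; (1.7) p. 178 uses `2δ_j` with `δ_j = g_jA₁p₀(g_j)` ((1.38) last equality, cell note T7).

WHAT IS PROVED (0 `sorry`, no `def`, no new `Prop`).
* `boundH141_of_ineq190` — *"ℍ_{j+1,□′} is bounded on □′^{∼2} by B₃exp(−δLM₂R_{j+1})22d²ε_{j+1}"*: from (190) for the size
  `bout` at every base point, (2.61), the argument field of (1.30) at `j + 1` of B-size `≤ 22d²ε_{j+1}` (the `2LM₁`-layer at
  `∂Z″_{j+2}`) vanishing on the blocks closer than `D` with `δLM₂R_{j+1} ≤ τD`, `Cκ_Bc ≤ B₃`, mean-value domination.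
* `ineq142_first_of_ineq190` — THE MIDDLE MEMBER: with the (1.37)-mechanism *"without the factor L"* as the hypothesis
  `diff′ ≤ c₃₇·(bout.loc y ℍ_{j+1,□′})` (`c₃₇ ≥ 0` its O(1); the tree's lattice form is `B15Ineq137Proof`), the flow relation
  `ε_{j+1} ≤ (1+β₀)ε_j` ([III] §2) and `ε_j = (A₀/A₁)δ_j` (cell note T7): `diff′ < C′·B₃e^{−δLM₂R_{j+1}}22d²(1+β₀)(A₀/A₁)δ_j`
  for any `C′ > c₃₇` (print's strict `<`; `δ_j, B₃, A₀/A₁ > 0`, `d ≠ 0`).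
* `ineq142_of_ineq190_gamma` — **the typed leaf `Ineq142` END-TO-END**: the middle member as above and the last member
  *"≦ ½δ_j"* from `B15GammaSmallness.ineq142_second_of_gamma` (explicit clause `C′B₃22d²(1+β₀)(A₀/A₁)γ² ≤ ½`, (2.5),
  `δLM₂ ≥ 1`, `0 < g_{j+1} ≤ γ ≤ e^{−1/2}`).
* `deltaPrime_le_ratio_delta`, `deltaPrime_lt_threeQuarter_delta_of_gamma` — **(1.43)'s clause**: along a flow with
  `0 < g_k ≤ γ < 1`, `p₁ < p₀`, `A₁ > 0`: `δ′_j ≤ (log γ⁻²)⁻¹·δ_j`, hence `δ′_j < ¾δ_j` as soon as `log γ⁻² > 4/3` — the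
  hypothesis `hδ` of r12's `B15SmallField185.sf17_of_reps` (*"2δ′_j + ½δ_j < 2δ_j"*).
HONEST SCOPE.  As in `B15HDecayLeaves`: (190), (2.61), B-size/localisation of the argument field, the (1.37)-mechanism
constant and the mean-value domination are hypotheses in their printed shapes.  NOT summit progress.
-/

namespace Literature.MathematicalPhysics.QuantumFieldTheory.Balaban1983to89.B15Ineq142Proof

open Literature.MathematicalPhysics.QuantumFieldTheory.Balaban1983to89
open B11SectG B15.PrelimIntegrations B15.Ineq194Flow B15HDecayLeaves B15GammaSmallness

/-! ## §1. The bound on `ℍ_{j+1,□′}` and the middle member of (1.42) -/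

section Decay

variable {g : B6.Geometry} {FB FA : Type} [AddCommGroup FB] [Module ℝ FB] [AddCommGroup FA] [Module ℝ FA]

/-- **p. 185**: *"The function ℍ_{j+1,□′} is bounded on □′^{∼2} by B₃exp(−δLM₂R_{j+1})22d²ε_{j+1}"* — from (190) for the
size `bout` at every base point, (2.61) at rate `σ`, `τ ≥ 0` with `σ + τ ≤ ⅛δ₀`, the argument field `B` of B-size
`≤ 22d²ε_{j+1}` vanishing on the blocks `y′` with `d(y, y′) < D`, `δLM₂R ≤ τD` (`R = R_{j+1}`), `Cκ_Bc ≤ B₃`, and the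
mean-value domination. [cite: Balaban1989LargeFieldI, (1.42) p.185; Balaban1985Variational, (190) p.308] -/
theorem boundH141_of_ineq190 {T : Type*} {bB : BlockNorm g FB} {bout : BlockNorm g FA}
    {dH : T → FB →ₗ[ℝ] FA} {C δ₀ σ τ c D B₃ δ L M₂ R d εj1 : ℝ}
    (h190 : ∀ t, Ineq190 bB bout (dH t) C δ₀) (hC : 0 ≤ C) (hd : ∀ a b : g.Site, 0 ≤ g.dist a b)
    (hrow : RowSum g σ c) (hτ : 0 ≤ τ) (hστ : σ + τ ≤ δ₀ / 8) (B : FB) (y : g.Site)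
    (hm : ∀ y', bB.loc y' B ≤ 22 * d ^ 2 * εj1) (hD : ∀ y', bB.loc y' B ≠ 0 → D ≤ g.dist y y')
    {HB : FA} (hmv : ∀ s : ℝ, (∀ t, bout.loc y (dH t B) ≤ s) → bout.loc y HB ≤ s)
    (hgeom : δ * L * M₂ * R ≤ τ * D) (hCB : C * bB.κ * c ≤ B₃) (hB₃ : 0 ≤ B₃) (hε : 0 ≤ εj1) :
    bout.loc y HB ≤ B₃ * Real.exp (-(δ * L * M₂ * R)) * (22 * d ^ 2) * εj1 := by
  have h := loc_le_of_meanValue h190 hC hd hrow hτ hστ B hm y hD hmv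
  have hexp : Real.exp (-(τ * D)) ≤ Real.exp (-(δ * L * M₂ * R)) := Real.exp_le_exp.mpr (by linarith)
  have ha : 0 ≤ 22 * d ^ 2 * εj1 := by positivity
  have h2 : C * bB.κ * c * (22 * d ^ 2 * εj1) * Real.exp (-(τ * D))
      ≤ B₃ * (22 * d ^ 2 * εj1) * Real.exp (-(δ * L * M₂ * R)) :=
    mul_le_mul (mul_le_mul_of_nonneg_right hCB ha) hexp (Real.exp_nonneg _) (by positivity)
  calc bout.loc y HB ≤ B₃ * (22 * d ^ 2 * εj1) * Real.exp (-(δ * L * M₂ * R)) := h.trans h2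
    _ = B₃ * Real.exp (-(δ * L * M₂ * R)) * (22 * d ^ 2) * εj1 := by ring

/-- **(1.42), MIDDLE MEMBER, p. 185**: with the bound on `ℍ_{j+1,□′}` (`boundH141_of_ineq190`'s inputs), the
(1.37)-mechanism *"without the factor L"* (`diff′ ≤ c₃₇·sH`, `diff′ = |exp iℍ^{(j)}_{□′}(b) − 1|`, `c₃₇ ≥ 0`), the flow
`ε_{j+1} ≤ (1+β₀)ε_j` and `ε_j = (A₀/A₁)δ_j`: `diff′ < C′B₃e^{−δLM₂R_{j+1}}22d²(1+β₀)(A₀/A₁)δ_j` for any `C′ > c₃₇` (print's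
`O(1)`), given `B₃, δ_j, A₀/A₁ > 0`, `β₀ ≥ 0`, `d ≠ 0`. [cite: Balaban1989LargeFieldI, (1.42) p.185] -/
theorem ineq142_first_of_ineq190 {T : Type*} {bB : BlockNorm g FB} {bout : BlockNorm g FA}
    {dH : T → FB →ₗ[ℝ] FA} {C δ₀ σ τ c D B₃ δ L M₂ R d εj εj1 β₀ A₀ A₁ δj c37 C' diff' : ℝ}
    (h190 : ∀ t, Ineq190 bB bout (dH t) C δ₀) (hC : 0 ≤ C) (hd : ∀ a b : g.Site, 0 ≤ g.dist a b)
    (hrow : RowSum g σ c) (hτ : 0 ≤ τ) (hστ : σ + τ ≤ δ₀ / 8) (B : FB) (y : g.Site)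
    (hm : ∀ y', bB.loc y' B ≤ 22 * d ^ 2 * εj1) (hD : ∀ y', bB.loc y' B ≠ 0 → D ≤ g.dist y y')
    {HB : FA} (hmv : ∀ s : ℝ, (∀ t, bout.loc y (dH t B) ≤ s) → bout.loc y HB ≤ s)
    (hgeom : δ * L * M₂ * R ≤ τ * D) (hCB : C * bB.κ * c ≤ B₃) (hB₃ : 0 < B₃)
    (h37 : diff' ≤ c37 * bout.loc y HB) (hc37 : 0 ≤ c37) (hC' : c37 < C')
    (hflow : εj1 ≤ (1 + β₀) * εj) (hεδ : εj = A₀ / A₁ * δj) (hβ₀ : 0 ≤ β₀) (hA : 0 < A₀ / A₁) (hδj : 0 < δj)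
    (hdd : d ≠ 0) :
    diff' < C' * B₃ * Real.exp (-(δ * L * M₂ * R)) * (22 * d ^ 2) * (1 + β₀) * (A₀ / A₁) * δj := by
  have hεj : 0 ≤ εj := by rw [hεδ]; positivity
  have hεj1 : 0 ≤ εj1 := by
    -- not needed for the chain but for `boundH141_of_ineq190`; derive from the B-size at `y`
    have := (bB.loc_nonneg y B).trans (hm y)
    have hd2 : 0 < 22 * d ^ 2 := by positivity
    nlinarith
  have h1 := boundH141_of_ineq190 h190 hC hd hrow hτ hστ B y hm hD hmv hgeom hCB hB₃.le hεj1
  set E : ℝ := Real.exp (-(δ * L * M₂ * R)) with hE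
  have hE0 : 0 < E := Real.exp_pos _
  -- `sH ≤ B₃E22d²ε_{j+1} ≤ B₃E22d²(1+β₀)(A₀/A₁)δ_j`
  have h2 : B₃ * E * (22 * d ^ 2) * εj1 ≤ B₃ * E * (22 * d ^ 2) * ((1 + β₀) * (A₀ / A₁ * δj)) := by
    rw [← hεδ]
    exact mul_le_mul_of_nonneg_left hflow (by positivity)
  have h3 : diff' ≤ c37 * (B₃ * E * (22 * d ^ 2) * ((1 + β₀) * (A₀ / A₁ * δj))) :=
    h37.trans (mul_le_mul_of_nonneg_left (h1.trans h2) hc37)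
  have hpos : 0 < B₃ * E * (22 * d ^ 2) * ((1 + β₀) * (A₀ / A₁ * δj)) := by
    have hd2 : 0 < d ^ 2 := by positivity
    positivity
  have h4 := mul_lt_mul_of_pos_right hC' hpos
  calc diff' ≤ c37 * (B₃ * E * (22 * d ^ 2) * ((1 + β₀) * (A₀ / A₁ * δj))) := h3
    _ < C' * (B₃ * E * (22 * d ^ 2) * ((1 + β₀) * (A₀ / A₁ * δj))) := h4
    _ = C' * B₃ * E * (22 * d ^ 2) * (1 + β₀) * (A₀ / A₁) * δj := by ring

/-- **(1.42) p. 185, the typed leaf `Ineq142` END-TO-END**: the middle member from (190) (`ineq142_first_of_ineq190`) and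
the last member *"≦ ½δ_j"* from the explicit γ-clause of `B15GammaSmallness.ineq142_second_of_gamma` ((2.5) for `R_{j+1}`,
`0 < g_{j+1} ≤ γ`, `log γ⁻² ≥ 1`, `δLM₂ ≥ 1`, `C′B₃22d²(1+β₀)(A₀/A₁)γ² ≤ ½`). [cite: Balaban1989LargeFieldI, (1.42) p.185] -/
theorem ineq142_of_ineq190_gamma {T : Type*} {bB : BlockNorm g FB} {bout : BlockNorm g FA}
    {dH : T → FB →ₗ[ℝ] FA} {C δ₀ σ τ c D B₃ δ L M₂ d εj εj1 β₀ A₀ A₁ δj c37 C' diff' γ gj1 : ℝ}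
    {Lnat r R : ℕ}
    (h190 : ∀ t, Ineq190 bB bout (dH t) C δ₀) (hC : 0 ≤ C) (hd : ∀ a b : g.Site, 0 ≤ g.dist a b)
    (hrow : RowSum g σ c) (hτ : 0 ≤ τ) (hστ : σ + τ ≤ δ₀ / 8) (B : FB) (y : g.Site)
    (hm : ∀ y', bB.loc y' B ≤ 22 * d ^ 2 * εj1) (hD : ∀ y', bB.loc y' B ≠ 0 → D ≤ g.dist y y')
    {HB : FA} (hmv : ∀ s : ℝ, (∀ t, bout.loc y (dH t B) ≤ s) → bout.loc y HB ≤ s)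
    (hgeom : δ * L * M₂ * R ≤ τ * D) (hCB : C * bB.κ * c ≤ B₃) (hB₃ : 0 < B₃)
    (h37 : diff' ≤ c37 * bout.loc y HB) (hc37 : 0 ≤ c37) (hC' : c37 < C')
    (hflow : εj1 ≤ (1 + β₀) * εj) (hεδ : εj = A₀ / A₁ * δj) (hβ₀ : 0 ≤ β₀) (hA : 0 < A₀ / A₁) (hδj : 0 < δj)
    (hdd : d ≠ 0)
    (hr : 1 ≤ r) (hR : B14.IsRj Lnat r gj1 R) (hg : 0 < gj1) (hgγ : gj1 ≤ γ) (hγe : 1 ≤ Real.log (γ ^ 2)⁻¹)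
    (hc1 : 1 ≤ δ * L * M₂) (hγ : C' * B₃ * (22 * d ^ 2) * (1 + β₀) * (A₀ / A₁) * γ ^ 2 ≤ 1 / 2) :
    Ineq142 diff' C' B₃ δ L M₂ R d β₀ A₀ A₁ δj := by
  have hfirst := ineq142_first_of_ineq190 h190 hC hd hrow hτ hστ B y hm hD hmv hgeom hCB hB₃ h37 hc37 hC' hflow
    hεδ hβ₀ hA hδj hdd
  have hK : 0 ≤ C' * B₃ * (22 * d ^ 2) * (1 + β₀) * (A₀ / A₁) := by
    have hC'0 : 0 ≤ C' := hc37.trans hC'.le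
    positivity
  exact ineq142_of_gamma hr hfirst hR hg hgγ hγe hc1 hK hδj.le hγ

end Decay

/-! ## §2. (1.43): the clause `δ′_j < ¾δ_j` from γ -/

section Ratio

variable {F : Flow} {γ : ℝ} {K : ℕ}

/-- `δ′_j ≤ (log γ⁻²)⁻¹·δ_j` along a flow with `0 < g_k ≤ γ < 1`, `p₁ < p₀`, `A₁ ≥ 0`, `log γ⁻² ≥ 1` (`δ_j = g_jA₁p₀(g_j) =
epsK A₁ p₀`, `δ′_j = g_jA₁p₁(g_j)`): the ratio `p₁(g_j)/p₀(g_j)` is *"a negative power of log g_j⁻²"* (p. 185).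
[cite: Balaban1989LargeFieldI, (1.38) p.185] -/
theorem deltaPrime_le_ratio_delta {A₁ : ℝ} (hA₁ : 0 ≤ A₁) {p₀ p₁ : ℕ} (hp : p₁ < p₀) (hI : F.InInterval γ K)
    (hγ1 : γ < 1) (hγe : 1 ≤ Real.log (γ ^ 2)⁻¹) {j : ℕ} (hj : j ≤ K) :
    deltaPrimeK A₁ p₁ F j ≤ (Real.log (γ ^ 2)⁻¹)⁻¹ * epsK A₁ p₀ F j := by
  obtain ⟨hg, hgγ⟩ := hI j hj
  have hg1 : F.g j < 1 := hgγ.trans_lt hγ1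
  have hratio := logPow_ratio_le hp hg hgγ hγe
  have hp0 : 0 < logPow p₀ (F.g j) := logPow_pos hg hg1 p₀
  have h1 : logPow p₁ (F.g j) ≤ (Real.log (γ ^ 2)⁻¹)⁻¹ * logPow p₀ (F.g j) := by
    rw [div_le_iff₀ hp0] at hratio
    exact hratio
  rw [deltaPrimeK, epsK, p0Profile_eq_mul_logPow, p0Profile_eq_mul_logPow]
  have hgA : 0 ≤ F.g j * A₁ := mul_nonneg hg.le hA₁
  calc F.g j * (A₁ * logPow p₁ (F.g j)) = F.g j * A₁ * logPow p₁ (F.g j) := by ring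
    _ ≤ F.g j * A₁ * ((Real.log (γ ^ 2)⁻¹)⁻¹ * logPow p₀ (F.g j)) := mul_le_mul_of_nonneg_left h1 hgA
    _ = (Real.log (γ ^ 2)⁻¹)⁻¹ * (F.g j * (A₁ * logPow p₀ (F.g j))) := by ring

/-- **(1.43) p. 185, the clause `δ′_j < ¾δ_j`** (⇔ *"2δ′_j + ½δ_j < 2δ_j"*, the hypothesis `hδ` of
`B15SmallField185.sf17_of_reps`): along a flow with `0 < g_k ≤ γ < 1`, `p₁ < p₀`, `A₁ > 0` and `log γ⁻² > 4/3`.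
[cite: Balaban1989LargeFieldI, (1.43) p.185] -/
theorem deltaPrime_lt_threeQuarter_delta_of_gamma {A₁ : ℝ} (hA₁ : 0 < A₁) {p₀ p₁ : ℕ} (hp : p₁ < p₀)
    (hI : F.InInterval γ K) (hγ1 : γ < 1) (hγe : 4 / 3 < Real.log (γ ^ 2)⁻¹) {j : ℕ} (hj : j ≤ K) :
    deltaPrimeK A₁ p₁ F j < 3 / 4 * epsK A₁ p₀ F j := by
  obtain ⟨hg, hgγ⟩ := hI j hj
  have hg1 : F.g j < 1 := hgγ.trans_lt hγ1
  have h1 := deltaPrime_le_ratio_delta hA₁.le hp hI hγ1 (by linarith) hj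
  have hδ : 0 < epsK A₁ p₀ F j := by
    rw [epsK, p0Profile_eq_mul_logPow]
    exact mul_pos hg (mul_pos hA₁ (logPow_pos hg hg1 p₀))
  have hinv : (Real.log (γ ^ 2)⁻¹)⁻¹ < 3 / 4 := by
    have hlog : 0 < Real.log (γ ^ 2)⁻¹ := by linarith
    have h' : (Real.log (γ ^ 2)⁻¹)⁻¹ < (4 / 3 : ℝ)⁻¹ := (inv_lt_inv₀ hlog (by norm_num)).mpr hγe
    have h34 : ((4 : ℝ) / 3)⁻¹ = 3 / 4 := by norm_num
    rwa [h34] at h'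
  exact h1.trans_lt (mul_lt_mul_of_pos_right hinv hδ)

end Ratio

end Literature.MathematicalPhysics.QuantumFieldTheory.Balaban1983to89.B15Ineq142Proof
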